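/-
Copyright: the b2b-balaban T⁴-continuum CRUX team, row NE7b OWNER lineage `t4-ne7b-p1` (gen 122). Project licence.
-/
import Summits.QuantumFields.BalabanUV.T4Continuum.Spine.NE7b.SupTorusPerturbedResolvent

/-!
# EXPONENTIALLY DECAYING KERNELS ARE ADMISSIBLE PERTURBATIONS OF THE HESSIAN: if `|K(x,z)| ≤ ε·e^{−γρ_N(x,z)}` on the fine torus and the
# Combes–Thomas weight is `θ`-Lipschitz for the `ℓ¹` circular distance with `θ < γ`, then the conjugated row AND column sums are
# `≤ ε·(2∕(1 − e^{−(γ−θ)}))^d` ((132) `torus_sum_exp_le`), so (162) gives the weighted resolvent letter for `H + K` with the floor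
# `m_w − εK_{γ−θ}` and injectivity of `H + K` when `εK_γ < min(2,a) − λ`; the road's own weights `(κ∕(n+1))ρ_N(·, c)` are `κ∕(n+1)`-Lipschitz
# (row NE7b, node U5c; (131)∕(132)∕(162) BY NAME; [folklore])

Cell `pub-balaban`, sub-cell `t4`, spine estimate NE7b (`T4WeightBudget.RelWeightBound`; the cell's OWN estimate — NOT PRINTED in
[Bałaban 1983–89], NOT PROVED).  Crux-route work under `Spine/NE7b/` by the row OWNER (`t4-ne7b-p1` gen 122, file (163)) under FREEZE
(0)'s crux-prover clause; NOTHING of Bałaban's is named as a Lean object, valued or asserted; no `T4Continuum/Support` leaf typed; no `def`,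
no notation; zero `sorry`.  Imports (BY NAME): the OWNER's (162) `…SupTorusPerturbedResolvent` (`perturbed_kernel_resolvent_le`,
`perturbed_injective`; through it (132) `isPseudoDist_torus`, `torus_sum_exp_le`).

WHY (located).  (162) reduced the perturbed resolvent letter to two weighted kernel sums; for the kernels the road produces — the next
action's Hessian `(n+1)^d T⁻¹` has `|T⁻¹(y,y′)| ≤ c₁e^{−δ₁ρ_s(y,y′)}` ((135)), and every later correction inherits an exponential profile —
those sums are the `ℓ¹` circular exponential sums of (132) once the weight's growth rate is below the kernel's decay rate; the road's
Combes–Thomas weights grow at rate `κ∕(n+1) ≤ κ ≤ 1` per unit of `ρ_N`.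

WHAT IS PROVED ([folklore]; any torus `Site d N`, `[NeZero N]`, `ρ_N` the `ℓ¹` circular distance; `K_α := (2∕(1 − e^{−α}))^d`):
* §1 `conjugated_entry_le` (`|K x z| ≤ εe^{−γρ(x,z)}`, `|w x − w z| ≤ θρ(x,z)` ⟹ `|K x z|e^{w x − w z} ≤ εe^{−(γ−θ)ρ(x,z)}`),
  **`weighted_rowsum_le`**, **`weighted_colsum_le`** (`θ < γ`, `ε ≥ 0` ⟹ both conjugated sums `≤ εK_{γ−θ}`), `rowsum_le`, `colsum_le` (zero weight).
* §2 `distance_weight_lipschitz` (`w = c₀·ρ_N(·, c)`, `c₀ ≥ 0` ⟹ `|w x − w z| ≤ c₀ρ_N(x,z)`).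
* §3 **`decaying_kernel_resolvent_le`** ((131)'s letters for `w` + `θ`-Lipschitz `w`, `θ < γ`, `εK_{γ−θ} < m_w`, `(H + K)u = f` ⟹
  `‖e^{w}u‖₂ ≤ (m_w − εK_{γ−θ})⁻¹‖e^{w}f‖₂`), **`decaying_kernel_injective`** (`εK_γ < min(2,a) − λ` ⟹ `H + K` injective).
* §4 toy.

HONEST (what this is NOT).  Bookkeeping on top of (162); the columns (132)–(161) for `H + K` remain to be re-derived; cubic periods;
scalar skeleton ((A3), NC-NE7b-α UNRULED); nothing of Bałaban's.  BY-NAME EFFECT ON THE WALL: NONE.  NE7b NOT PRINTED ∕ NOT PROVED; spine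
PROVED 0∕9; rung (B)+1 on a FINITE torus — NOT infinite volume, NOT the mass gap, NOT Clay.  HONEST DEPENDENCY: continuum YM on T⁴ ⇐
BetaPertH ∧ nine spine estimates (0∕9 proved); BetaPertH ⇐ (D1) ∧ (D4) ∧ CAP+tail; G-an2-4 gates asym, D1 and NE2∕3∕4.
-/

set_option autoImplicit false

noncomputable section

namespace Summit.QuantumFields.BalabanUV.T4Continuum.NE7b.SupTorusPerturbedKernelSums

open Real
open Literature.MathematicalPhysics.QuantumFieldTheory.Balaban1983to89
open B6QGQLower276 (X e blk B side chart mem_B sum_B sum_B_const card_cube)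
open Beta (Site siteOf windowMap siteOf_windowMap siteOf_add)
open SupTorusBlockDistance (isPseudoDist_torus torus_sum_exp_le)
open SupTorusPerturbedResolvent (perturbed_kernel_resolvent_le perturbed_injective)

variable {d : ℕ}

/-! ## §1. Conjugated sums of exponentially decaying kernels -/

section Sums

variable (N : ℕ) [NeZero N] (K : Site d N → Site d N → ℝ) (w : Site d N → ℝ) {ε γ θ : ℝ} (hε : 0 ≤ ε)
  (hK : ∀ x z, |K x z| ≤ ε * exp (-(γ * ∑ i, (((x i - z i).valMinAbs.natAbs : ℕ) : ℝ))))
  (hw : ∀ x z, |w x - w z| ≤ θ * ∑ i, (((x i - z i).valMinAbs.natAbs : ℕ) : ℝ))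

omit [NeZero N] in
include hε hK hw in
/-- A conjugated entry: `|K x z|e^{w x − w z} ≤ εe^{−(γ−θ)ρ(x,z)}`. [folklore] -/
theorem conjugated_entry_le (x z : Site d N) :
    |K x z| * exp (w x - w z) ≤ ε * exp (-((γ - θ) * ∑ i, (((x i - z i).valMinAbs.natAbs : ℕ) : ℝ))) := by
  have h1 : exp (w x - w z) ≤ exp (θ * ∑ i, (((x i - z i).valMinAbs.natAbs : ℕ) : ℝ)) :=
    exp_le_exp.2 ((le_abs_self _).trans (hw x z))
  calc |K x z| * exp (w x - w z)
      ≤ (ε * exp (-(γ * ∑ i, (((x i - z i).valMinAbs.natAbs : ℕ) : ℝ)))) * exp (θ * ∑ i, (((x i - z i).valMinAbs.natAbs : ℕ) : ℝ)) :=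
        mul_le_mul (hK x z) h1 (exp_pos _).le (by positivity)
    _ = ε * exp (-((γ - θ) * ∑ i, (((x i - z i).valMinAbs.natAbs : ℕ) : ℝ))) := by
        rw [mul_assoc, ← exp_add]; congr 1; congr 1; ring

include hε hK hw in
/-- **THE CONJUGATED ROW SUMS ARE `≤ εK_{γ−θ}`** (`θ < γ`). [folklore] -/
theorem weighted_rowsum_le (hθγ : θ < γ) (x : Site d N) :
    ∑ z, |K x z| * exp (w x - w z) ≤ ε * (2 * (1 - exp (-(γ - θ)))⁻¹) ^ d := by
  have hsum := torus_sum_exp_le (d := d) N (sub_pos.2 hθγ) x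
  calc ∑ z : Site d N, |K x z| * exp (w x - w z)
      ≤ ∑ z : Site d N, ε * exp (-((γ - θ) * ∑ i, (((x i - z i).valMinAbs.natAbs : ℕ) : ℝ))) :=
        Finset.sum_le_sum fun z _ => conjugated_entry_le N K w hε hK hw x z
    _ = ε * ∑ z : Site d N, exp (-((γ - θ) * ∑ i, (((x i - z i).valMinAbs.natAbs : ℕ) : ℝ))) := (Finset.mul_sum _ _ _).symm
    _ ≤ _ := mul_le_mul_of_nonneg_left hsum hε

include hε hK hw in
/-- **THE CONJUGATED COLUMN SUMS ARE `≤ εK_{γ−θ}`** (`θ < γ`; `ρ` symmetric). [folklore] -/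
theorem weighted_colsum_le (hθγ : θ < γ) (z : Site d N) :
    ∑ x, |K x z| * exp (w x - w z) ≤ ε * (2 * (1 - exp (-(γ - θ)))⁻¹) ^ d := by
  have hsum := torus_sum_exp_le (d := d) N (sub_pos.2 hθγ) z
  have hsymm := (isPseudoDist_torus (d := d) N).symm
  calc ∑ x : Site d N, |K x z| * exp (w x - w z)
      ≤ ∑ x : Site d N, ε * exp (-((γ - θ) * ∑ i, (((z i - x i).valMinAbs.natAbs : ℕ) : ℝ))) :=
        Finset.sum_le_sum fun x _ => by rw [hsymm z x]; exact conjugated_entry_le N K w hε hK hw x z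
    _ = ε * ∑ x : Site d N, exp (-((γ - θ) * ∑ i, (((z i - x i).valMinAbs.natAbs : ℕ) : ℝ))) := (Finset.mul_sum _ _ _).symm
    _ ≤ _ := mul_le_mul_of_nonneg_left hsum hε

include hε hK in
/-- Plain row sums (zero weight): `Σ_z |K x z| ≤ εK_γ` (`γ > 0`). [folklore] -/
theorem rowsum_le (hγ : 0 < γ) (x : Site d N) : ∑ z, |K x z| ≤ ε * (2 * (1 - exp (-γ))⁻¹) ^ d := by
  have h := weighted_rowsum_le N K (fun _ => (0 : ℝ)) (θ := 0) hε hK (fun x z => by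
    rw [sub_self, abs_zero, zero_mul]) (by simpa using hγ) x
  simpa using h

include hε hK in
/-- Plain column sums (zero weight): `Σ_x |K x z| ≤ εK_γ` (`γ > 0`). [folklore] -/
theorem colsum_le (hγ : 0 < γ) (z : Site d N) : ∑ x, |K x z| ≤ ε * (2 * (1 - exp (-γ))⁻¹) ^ d := by
  have h := weighted_colsum_le N K (fun _ => (0 : ℝ)) (θ := 0) hε hK (fun x z => by
    rw [sub_self, abs_zero, zero_mul]) (by simpa using hγ) z
  simpa using h

end Sums

/-! ## §2. The road's weights are Lipschitz for the circular distance -/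

/-- **DISTANCE WEIGHTS ARE LIPSCHITZ**: `w = c₀·ρ_N(·, c)` with `c₀ ≥ 0` satisfies `|w x − w z| ≤ c₀ρ_N(x,z)` (triangle inequality of (132)'s
pseudo-distance) — the Combes–Thomas weights of (131)–(161) have `c₀ = κ∕(n+1)`. [folklore] -/
theorem distance_weight_lipschitz (N : ℕ) [NeZero N] {c₀ : ℝ} (hc₀ : 0 ≤ c₀) (c x z : Site d N) :
    |c₀ * ∑ i, (((x i - c i).valMinAbs.natAbs : ℕ) : ℝ) - c₀ * ∑ i, (((z i - c i).valMinAbs.natAbs : ℕ) : ℝ)|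
      ≤ c₀ * ∑ i, (((x i - z i).valMinAbs.natAbs : ℕ) : ℝ) := by
  have hP := isPseudoDist_torus (d := d) N
  have h1 : ∑ i, (((x i - c i).valMinAbs.natAbs : ℕ) : ℝ) ≤ ∑ i, (((x i - z i).valMinAbs.natAbs : ℕ) : ℝ)
      + ∑ i, (((z i - c i).valMinAbs.natAbs : ℕ) : ℝ) := hP.triangle x z c
  have h2 : ∑ i, (((z i - c i).valMinAbs.natAbs : ℕ) : ℝ) ≤ ∑ i, (((z i - x i).valMinAbs.natAbs : ℕ) : ℝ)
      + ∑ i, (((x i - c i).valMinAbs.natAbs : ℕ) : ℝ) := hP.triangle z x c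
  have h3 : ∑ i, (((z i - x i).valMinAbs.natAbs : ℕ) : ℝ) = ∑ i, (((x i - z i).valMinAbs.natAbs : ℕ) : ℝ) := hP.symm z x
  rw [h3] at h2
  rw [← mul_sub, abs_mul, abs_of_nonneg hc₀]
  refine mul_le_mul_of_nonneg_left (abs_le.2 ⟨by linarith, by linarith⟩) hc₀

/-! ## §3. The resolvent letter and injectivity for `H + K` with an exponentially decaying kernel -/

section Resolvent

variable (n : ℕ) (a : ℝ) (s : ℕ) [NeZero s] (ha : 0 ≤ a) (u w V f : Site d ((n + 1) * s) → ℝ)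
  (K : Site d ((n + 1) * s) → Site d ((n + 1) * s) → ℝ) {τ β lam ε γ θ : ℝ} (hτ : τ ≤ 1)
  (hwb : ∀ x μ, |w (x + siteOf d ((n + 1) * s) (e μ)) - w x| ≤ τ)
  (hwB : ∀ (y : Site d s) (z z' : Fin d → Fin (n + 1)),
    |w (siteOf d ((n + 1) * s) (chart n (windowMap d s y) z)) - w (siteOf d ((n + 1) * s) (chart n (windowMap d s y) z'))| ≤ β)
  (hwL : ∀ x z, |w x - w z| ≤ θ * ∑ i, (((x i - z i).valMinAbs.natAbs : ℕ) : ℝ))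
  (hV : ∀ x, -lam ≤ V x) (hε : 0 ≤ ε) (hθγ : θ < γ)
  (hK : ∀ x z, |K x z| ≤ ε * exp (-(γ * ∑ i, (((x i - z i).valMinAbs.natAbs : ℕ) : ℝ))))
  (hm : ε * (2 * (1 - exp (-(γ - θ)))⁻¹) ^ d < min 2 a - lam - 2 * d * (((n : ℝ) + 1) * τ) ^ 2 - a * (exp β - 1))
  (hu : ∀ x, ((n : ℝ) + 1) ^ 2 * ∑ μ, (2 * u x - u (x + siteOf d ((n + 1) * s) (e μ)) - u (x - siteOf d ((n + 1) * s) (e μ)))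
      + a / ((n : ℝ) + 1) ^ d * ∑ q ∈ B n (blk n (windowMap d ((n + 1) * s) x)), u (siteOf d ((n + 1) * s) q)
      + V x * u x + ∑ z, K x z * u z = f x)

include ha hτ hwb hwB hwL hV hε hθγ hK hm hu in
/-- **THE WEIGHTED RESOLVENT LETTER FOR `H + K`, `K` EXPONENTIALLY DECAYING**: with (131)'s weight letters `τ, β`, a `θ`-Lipschitz weight,
`|K(x,z)| ≤ εe^{−γρ(x,z)}`, `θ < γ` and `εK_{γ−θ} < m_w`: `‖e^{w}u‖₂ ≤ (m_w − εK_{γ−θ})⁻¹‖e^{w}f‖₂` ((162) ⊛ §1). [folklore] -/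
theorem decaying_kernel_resolvent_le :
    √(∑ x, (exp (w x) * u x) ^ 2)
      ≤ (min 2 a - lam - 2 * d * (((n : ℝ) + 1) * τ) ^ 2 - a * (exp β - 1) - ε * (2 * (1 - exp (-(γ - θ)))⁻¹) ^ d)⁻¹
        * √(∑ x, (exp (w x) * f x) ^ 2) := by
  have hr : 0 ≤ ε * (2 * (1 - exp (-(γ - θ)))⁻¹) ^ d :=
    mul_nonneg hε (pow_nonneg (mul_nonneg zero_le_two (inv_nonneg.2 (sub_nonneg.2 (exp_le_one_iff.2 (by linarith))))) d)
  exact perturbed_kernel_resolvent_le n a s ha u w V f K hτ hwb hwB hV hr hm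
    (weighted_rowsum_le ((n + 1) * s) K w hε hK hwL hθγ) (weighted_colsum_le ((n + 1) * s) K w hε hK hwL hθγ) hu

end Resolvent

/-- **`H + K` IS INJECTIVE FOR EXPONENTIALLY DECAYING `K`** when `V ≥ −λ`, `a ≥ 0`, `|K(x,z)| ≤ εe^{−γρ(x,z)}`, `γ > 0` and
`εK_γ < min(2,a) − λ`. [folklore] -/
theorem decaying_kernel_injective (n : ℕ) (a : ℝ) (s : ℕ) [NeZero s] (ha : 0 ≤ a) {lam ε γ : ℝ} (hε : 0 ≤ ε) (hγ : 0 < γ)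
    (hm : ε * (2 * (1 - exp (-γ))⁻¹) ^ d < min 2 a - lam) (V : Site d ((n + 1) * s) → ℝ) (hV : ∀ x, -lam ≤ V x)
    (K : Site d ((n + 1) * s) → Site d ((n + 1) * s) → ℝ)
    (hK : ∀ x z, |K x z| ≤ ε * exp (-(γ * ∑ i, (((x i - z i).valMinAbs.natAbs : ℕ) : ℝ)))) (u u' : Site d ((n + 1) * s) → ℝ)
    (h : ∀ x, ((n : ℝ) + 1) ^ 2 * ∑ μ, (2 * u x - u (x + siteOf d ((n + 1) * s) (e μ)) - u (x - siteOf d ((n + 1) * s) (e μ)))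
        + a / ((n : ℝ) + 1) ^ d * ∑ q ∈ B n (blk n (windowMap d ((n + 1) * s) x)), u (siteOf d ((n + 1) * s) q) + V x * u x
        + ∑ z, K x z * u z
      = ((n : ℝ) + 1) ^ 2 * ∑ μ, (2 * u' x - u' (x + siteOf d ((n + 1) * s) (e μ)) - u' (x - siteOf d ((n + 1) * s) (e μ)))
        + a / ((n : ℝ) + 1) ^ d * ∑ q ∈ B n (blk n (windowMap d ((n + 1) * s) x)), u' (siteOf d ((n + 1) * s) q) + V x * u' x
        + ∑ z, K x z * u' z) :
    u = u' :=
  perturbed_injective n a s ha (mul_nonneg hε (pow_nonneg (mul_nonneg zero_le_two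
      (inv_nonneg.2 (sub_nonneg.2 (exp_le_one_iff.2 (by linarith))))) d)) hm V hV K
    (rowsum_le ((n + 1) * s) K hε hK hγ) (colsum_le ((n + 1) * s) K hε hK hγ) u u' h

/-! ## §4. Toy -/

/-- Toy (`d = 0`, `N = 1`): the zero kernel has conjugated row sums `≤ 0·K`. -/
example : ∑ z : Site 0 1, |(fun _ _ => (0 : ℝ)) (0 : Site 0 1) z| * exp ((fun _ => (0 : ℝ)) (0 : Site 0 1) - (fun _ => (0 : ℝ)) z)
    ≤ 0 * (2 * (1 - exp (-((1 : ℝ) - 0)))⁻¹) ^ 0 :=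
  weighted_rowsum_le (d := 0) 1 (fun _ _ => (0 : ℝ)) (fun _ => 0) (ε := 0) (γ := 1) (θ := 0) le_rfl
    (fun _ _ => by simp) (fun _ _ => by simp) one_pos 0

end Summit.QuantumFields.BalabanUV.T4Continuum.NE7b.SupTorusPerturbedKernelSums
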